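import Summits.HodgeConjecture.HodgeConjecture.Theorems.Ring2AbelianAllFrame
import HarnessLib

/-!
# Ring 2 · sub-cell AbelianAll, André axis, part IV — the `B_min` of part I GRADED BY RELATIVE DIMENSION:
# unconditional in relative dimension `≤ 3`, the doubling cost of Lemme 6.3.1 (`HC` in dimension `g` asks the
# transport input on fibres of dimension `2g`), and the dimension at which the André row first has content

HONEST FRAMING (page 1, verbatim): **research route, not a corollary; conditional on HC_CM plus one named
minimal statement.** Cell line: research route conditional on HC_CM; not a corollary; Q11.4-sentence-2
already refuted in dim ≥ 3. Nothing in this file proves a new case of the Hodge conjecture: the unconditional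
theorems below are the tree's `HC` in dimension `≤ 3` (Lefschetz (1,1) + hard Lefschetz on threefolds,
`hodgeConjectureFor_of_dim_le_three_holds`) moved onto compact pencils. `HC_CM` = `Theses.RankFourFaces.CMAbelianHodge`
(a BINDER, never cited); `HC_AV` = `Theses.PadicSemiregularLift.HodgeAbelianVarieties`; `HCAtDim g` / `HCUpToDim g`
are the LEAD's class targets (`Ring2ClassTargets`); the item `CMToAbelian` (stmt-16267) is OPEN and not closed here.
Seat `pub-hodge-ring2-ab-andre-2`, gen 1 (brief (iii): "smallest open instance … partial results as theorems").

## Content (one `@[conjecture]` family of nodes; theorems)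

* `CMAnchoredTransportAtRelDim d` — part I's `B_min` (node (4), `CMAnchoredTransport`: on a compact pencil of
  abelian varieties algebraicity spreads out of a CM fibre) asked ONLY of pencils of relative dimension `d`;
  `CMAnchoredTransport ↔ ∀ d, CMAnchoredTransportAtRelDim d` (`Iff.rfl`).
* GRADED ON-PATH: `HCAtDim d ⟹ (1.1) on every compact pencil of relative dimension d ⟹ CMAnchoredTransportAtRelDim d`
  (`invariantCyclesHoldFor_compactPencil_of_hcAtDim`; Charles–Schnell Cor. 11.3.6 fibre by fibre).
* PARTIAL RESULT (unconditional): `CMAnchoredTransportAtRelDim d` for `d ≤ 3`, indeed (1.1) on every compact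
  pencil of relative dimension `≤ 3` (`invariantCyclesHoldFor_compactPencil_of_le_three`) — the André-axis input is
  a THEOREM below relative dimension `4`; its first open relative dimension is `4` (fibres = abelian fourfolds, where
  the open classes are the Weil classes `W₄`; the cell's `Ring2AbelianAllWeilFloor` prices dimension `≤ 5`).
* THE DOUBLING COST of Lemme 6.3.1 (graded deliverable): `HC_CM ∧ CMAnchoredTransportAtRelDim (2g) ⟹ HCAtDim g`
  (mod Lemme 6.3.1, `h₂₁`) — André's pencil through a `g`-fold `A` has fibres isogenous to `A × A`, so `HC` in
  dimension `g` consumes the transport input on `2g`-dimensional fibres (total space of dimension `2g + 1`), which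
  in turn is implied only by `HCAtDim (2g)`; so on this axis the first `g` with open content, `g = 4`, already asks
  (1.1) out of CM fibres on pencils of abelian EIGHTFOLDS (9-dimensional total spaces). (The Weil-family pencils of
  the transport seat — `Ring2Transport.CMPointedWeilFamiliesQuadratic` — avoid the doubling for Weil classes: fibres
  of dimension `2n`; recorded in RING2-MAP §AbelianAll AA2.3, not re-typed here.)
* Consequently the unconditional relative dimensions `2g ≤ 3` serve only `g ≤ 1` through this axis
  (`hcAtDim_one_of_HC_CM_of_andre1996`), `HC_CM ∧ CMAnchoredTransportAtRelDim 8 ⟹ HCAtDim 4` is the first row with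
  content, and the `HCUpToDim g` form assumes the input at EVERY even relative dimension `2g'`, `g' ≤ g`
  (`CMAnchoredTransportAtRelDim` is not known to be monotone in `d`; no kernel argument relates different `d`).

References: Andre1996Motifs (Lemme 6.3.1 (i) "X_s isogène à A × A", p. 31; §6.3 a), p. 33); CharlesSchnell2014Notes
(Cor. 11.3.6); VoisinHodgeII2003 (§10.2.3: Lefschetz (1,1) and hard Lefschetz on threefolds); Deligne2000 (§1).
-/

noncomputable section

set_option linter.dupNamespace false

namespace Summit.HodgeConjecture.HodgeConjecture.Ring2.AbelianAll

open CategoryTheory AlgebraicGeometry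
open Literature.AlgebraicGeometry Literature.AlgebraicGeometry.Motives
open Literature.AlgebraicGeometry.HodgeTheory
open Literature.AlgebraicGeometry.Milne1999 (IsOfCMType)
open Literature.AlgebraicGeometry.Abdulali1994 (InvariantCyclesHoldFor)
open Literature.AlgebraicGeometry.Andre1996 (andre1996_cmAnchoredPencil)
open Literature.AlgebraicGeometry.Deligne1982 (cmLocus)
open Summit.HodgeConjecture.HodgeConjecture
open Summit.HodgeConjecture.HodgeConjecture.Theses
open Summit.HodgeConjecture.HodgeConjecture.Ring2.ClassTargets (HCAtDim HCUpToDim hcAtDim_of_le_three)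
open Summit.HodgeConjecture.HodgeConjecture.Theorems.HodgeAbelianVarieties.Negative (iff_hodgeConjecture_restricted)

/-! ## §A The graded node -/

/-- **`CMAnchoredTransportAtRelDim d` — part I's `B_min` (`CMAnchoredTransport`, REFEREE-AB candidate 4) on
compact pencils of relative dimension `d` only**: for every compact pencil of abelian varieties `f : 𝒳 ⟶ S` of
relative dimension `d`, every global class with rational `(p,p)` fibre restrictions, and every CM point
`t ∈ cmLocus f d`, algebraicity of the restriction at `t` implies algebraicity at every fibre. OPEN for `d ≥ 4`; a
THEOREM for `d ≤ 3` (`cmAnchoredTransportAtRelDim_of_le_three`); a HYPOTHESIS wherever used.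
[cite: Andre1996Motifs, §6.3 a) (p. 33)] [cite: Abdulali1994FamiliesAV, Lemma 6.2 (p. 1131)] -/
@[conjecture] def CMAnchoredTransportAtRelDim (d : ℕ) : Prop :=
  ∀ ⦃𝒳 S : SchemeOver ℂ⦄ (f : 𝒳 ⟶ S), IsCompactAbelianPencil f d →
    ∀ (p : ℕ) (W : complexBetti 𝒳 (2 * p)),
      (∀ s : ComplexPoints S, IsRationalClass (complexBetti.map (fiberι f s) (2 * p) W) ∧
        IsOfHodgeType d (fiberOver f s) (2 * p) p p (complexBetti.map (fiberι f s) (2 * p) W)) →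
      ∀ t ∈ cmLocus f d,
        complexBetti.map (fiberι f t) (2 * p) W ∈ algebraicClasses (fiberOver f t) p →
        ∀ s : ComplexPoints S, complexBetti.map (fiberι f s) (2 * p) W ∈ algebraicClasses (fiberOver f s) p

/-- Part I's node is the conjunction of the graded nodes over all relative dimensions (definitionally). [folklore] -/
theorem cmAnchoredTransport_iff_forall_atRelDim :
    CMAnchoredTransport ↔ ∀ d : ℕ, CMAnchoredTransportAtRelDim d :=
  Iff.rfl

/-! ## §B Graded on-path and the unconditional relative dimensions `≤ 3` -/

/-- **`HC` for abelian varieties of dimension `d` gives (1.1) on every compact pencil of relative dimension `d`**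
(Charles–Schnell Cor. 11.3.6, fibre by fibre: every fibre is `≅ A'.X` with `dim A' = d`,
`Andre1996.compactPencil_exists_abelianVariety_fiber_dim`; a rational `(p,p)` fibre class is algebraic by
`HCAtDim d` moved along the chart). [cite: CharlesSchnell2014Notes, Cor. 11.3.6 (p. 494)] -/
theorem invariantCyclesHoldFor_compactPencil_of_hcAtDim {d : ℕ} (h : HCAtDim d) {𝒳 S : SchemeOver ℂ}
    {f : 𝒳 ⟶ S} (hf : IsCompactAbelianPencil f d) : InvariantCyclesHoldFor f d := by
  intro q W hW _ s
  obtain ⟨B, hBdim, ⟨eB⟩⟩ := Andre1996.compactPencil_exists_abelianVariety_fiber_dim hf s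
  have hB : IsSmoothProjective B.dim B.X := AbelianVariety.isSmoothProjective_holds
  have hHCB := ((hodgeConjectureFor_iff_of_isSmoothProjective nonempty_hodgeModel_holds hB).1 (h B hBdim)) q
  rw [hBdim] at hHCB
  exact (forall_hodgeClass_mem_algebraicClasses_iff_of_iso eB q).1 hHCB _ (hW s).1 (hW s).2

/-- **Graded on-path**: `HCAtDim d ⟹ CMAnchoredTransportAtRelDim d`. [cite: CharlesSchnell2014Notes, Cor. 11.3.6 (p. 494)] -/
theorem cmAnchoredTransportAtRelDim_of_hcAtDim {d : ℕ} (h : HCAtDim d) : CMAnchoredTransportAtRelDim d :=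
  fun _ _ _ hf p W hW t _ h₀ s ↦ invariantCyclesHoldFor_compactPencil_of_hcAtDim h hf p W hW ⟨t, h₀⟩ s

/-- **PARTIAL RESULT (unconditional): (1.1) holds on every compact pencil of abelian varieties of relative
dimension `≤ 3`** — `HC` in dimension `≤ 3` is a theorem of the tree (`ClassTargets.hcAtDim_of_le_three`: Lefschetz
(1,1), hard Lefschetz on threefolds). [cite: VoisinHodgeII2003, §10.2.3] -/
theorem invariantCyclesHoldFor_compactPencil_of_le_three {d : ℕ} (hd : d ≤ 3) {𝒳 S : SchemeOver ℂ}
    {f : 𝒳 ⟶ S} (hf : IsCompactAbelianPencil f d) : InvariantCyclesHoldFor f d :=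
  invariantCyclesHoldFor_compactPencil_of_hcAtDim (hcAtDim_of_le_three hd) hf

/-- **PARTIAL RESULT (unconditional): the André-axis `B_min` holds in relative dimension `≤ 3`.** Its first open
relative dimension is `4`. [cite: VoisinHodgeII2003, §10.2.3] -/
theorem cmAnchoredTransportAtRelDim_of_le_three {d : ℕ} (hd : d ≤ 3) : CMAnchoredTransportAtRelDim d :=
  cmAnchoredTransportAtRelDim_of_hcAtDim (hcAtDim_of_le_three hd)

/-! ## §C The doubling cost of Lemme 6.3.1: `HC` in dimension `g` from the input on `2g`-dimensional fibres -/

/-- **GRADED DELIVERABLE: `HC_CM ∧ CMAnchoredTransportAtRelDim (2g) ⟹ HCAtDim g`, modulo Lemme 6.3.1 (`h₂₁`).**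
The pencil of Lemme 6.3.1 through a `g`-fold `A` has relative dimension `2·dim A` ("X_s isogène à A × A"), so the
proof of part I's `HC_AV_of_HC_CM_and_Bmin` for `A` consumes the transport input at relative dimension `2g` only
(and `HC_CM` only at the CM fibre, an abelian `2g`-fold of CM type, through `Ring2Transport.mem_algebraicClasses_of_cmChart`).
research route, not a corollary; conditional on HC_CM plus one named minimal statement.
[cite: Andre1996Motifs, Lemme 6.3.1 (i)–(ii) (p. 31) and §6.3 a) (p. 33)] -/
theorem hcAtDim_of_HC_CM_of_cmAnchoredTransportAtRelDim (h₂₁ : andre1996_cmAnchoredPencil)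
    (hCM : RankFourFaces.CMAbelianHodge) (g : ℕ) (hB : CMAnchoredTransportAtRelDim (2 * g)) : HCAtDim g := by
  intro A hAg
  subst hAg
  have hA : IsSmoothProjective A.dim A.X := AbelianVariety.isSmoothProjective_holds
  refine (hodgeConjectureFor_iff_of_isSmoothProjective nonempty_hodgeModel_holds hA).2 fun p c hc hpp ↦ ?_
  obtain ⟨𝒳, S, f, hf, s, t, W, A₁, A₀, e₁, g, q, hW, hq, hgc, ⟨e₀⟩, hA₀⟩ := h₂₁ A hA p c hc hpp
  have h₀ : complexBetti.map (fiberι f t) (2 * p) W ∈ algebraicClasses (fiberOver f t) p :=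
    Ring2Transport.mem_algebraicClasses_of_cmChart hCM A₀ e₀ (Andre1996.compactPencil_dim_eq_of_iso hf e₀)
      hA₀ (hW t).1 (hW t).2
  have h₁ := hB f hf p W hW t (mem_cmLocus_of_compactPencil hf e₀ hA₀) h₀ s
  have h₂ : complexBetti.map e₁.hom (2 * p) (complexBetti.map (fiberι f s) (2 * p) W) ∈
      algebraicClasses A₁.X p :=
    (mem_algebraicClasses_map_iff_of_iso e₁).2 h₁
  have h₃ : (q : ℂ) • c ∈ algebraicClasses A.X p := by
    rw [← hgc]
    exact map_mem_algebraicClasses_of_abelianVariety hA A₁ g.hom.hom.hom h₂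
  exact (Submodule.smul_mem_iff _ (Rat.cast_ne_zero.2 hq)).1 h₃

/-- **All dimensions up to `g` at once**: `HC_CM ∧ (∀ g' ≤ g, CMAnchoredTransportAtRelDim (2g')) ⟹ HCUpToDim g`
(the graded node is not known to be monotone in the relative dimension, so the input is assumed at every even
relative dimension `≤ 2g`). [cite: Andre1996Motifs, §6.3 a) (p. 33)] -/
theorem hcUpToDim_of_HC_CM_of_cmAnchoredTransportAtRelDim (h₂₁ : andre1996_cmAnchoredPencil)
    (hCM : RankFourFaces.CMAbelianHodge) (g : ℕ) (hB : ∀ g' ≤ g, CMAnchoredTransportAtRelDim (2 * g')) :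
    HCUpToDim g :=
  fun A hA ↦ hcAtDim_of_HC_CM_of_cmAnchoredTransportAtRelDim h₂₁ hCM A.dim (hB A.dim hA) A rfl

/-- **Where the André row first has content.** Through this axis, `HC_CM` and the unconditional relative
dimensions `2g ≤ 3` only return `HC` in dimension `g ≤ 1` (which is Lefschetz (1,1) anyway): the statement
`HCAtDim 1` obtained from `cmAnchoredTransportAtRelDim_of_le_three` at `2·1 = 2`. The first dimension with open
`HC`, `g = 4`, asks `CMAnchoredTransportAtRelDim 8`. [cite: Andre1996Motifs, Lemme 6.3.1 (p. 31)] -/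
theorem hcAtDim_one_of_HC_CM_of_andre1996 (h₂₁ : andre1996_cmAnchoredPencil) (hCM : RankFourFaces.CMAbelianHodge) :
    HCAtDim 1 :=
  hcAtDim_of_HC_CM_of_cmAnchoredTransportAtRelDim h₂₁ hCM 1 (cmAnchoredTransportAtRelDim_of_le_three (by omega))

/-- **The `g = 4` row, stated**: `HC_CM ∧ CMAnchoredTransportAtRelDim 8 ⟹ HCAtDim 4` (mod Lemme 6.3.1) — on this
axis the abelian FOURFOLDS (Weil classes `W₄`) cost (1.1) out of CM fibres on compact pencils of abelian
EIGHTFOLDS. [cite: Andre1996Motifs, Lemme 6.3.1 (p. 31) and §6.3 a) (p. 33)] -/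
theorem hcAtDim_four_of_HC_CM_of_cmAnchoredTransportAtRelDim_eight (h₂₁ : andre1996_cmAnchoredPencil)
    (hCM : RankFourFaces.CMAbelianHodge) (hB : CMAnchoredTransportAtRelDim 8) : HCAtDim 4 :=
  hcAtDim_of_HC_CM_of_cmAnchoredTransportAtRelDim h₂₁ hCM 4 hB

/-- **Graded on-path for the doubled input**: `HCAtDim (2g) ⟹ CMAnchoredTransportAtRelDim (2g)`; so, granted
`HC_CM` and Lemme 6.3.1, `HCAtDim (2g) ⟹ HCAtDim g` THROUGH this axis (the product trick gives it directly,
`ClassTargets.hcAtDim_mono`; recorded to exhibit that the graded exactness "`HCAtDim g ↔ HC_CM ∧ input(2g)`" is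
NOT available — the converse arrow would need `HC` in dimension `2g`). [folklore] -/
theorem hcAtDim_of_HC_CM_of_hcAtDim_double (h₂₁ : andre1996_cmAnchoredPencil) (hCM : RankFourFaces.CMAbelianHodge)
    (g : ℕ) (h : HCAtDim (2 * g)) : HCAtDim g :=
  hcAtDim_of_HC_CM_of_cmAnchoredTransportAtRelDim h₂₁ hCM g (cmAnchoredTransportAtRelDim_of_hcAtDim h)

end Summit.HodgeConjecture.HodgeConjecture.Ring2.AbelianAll

end
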